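import Literature.NumberTheory.Automorphic.UnitaryGroupDualPairCarriers
import Literature.NumberTheory.Automorphic.UnitaryGroupLevelTransport
import Literature.NumberTheory.Automorphic.UnitaryGroupAdelicContinuity
import HarnessLib

/-!
# The dual pair with a hermitian LINE: `a : U(J_V)(𝔸_F) → G₁(𝔸_F) = U(J_V ⊗ J_W)(𝔸_F)` is an isomorphism of
# topological groups

Topic `NumberTheory/Automorphic`; namespace `Literature.NumberTheory.Automorphic.UnitaryGroup` (continues
`UnitaryGroupDualPairCarriers`).  KERNEL ONLY: proved theorems; no definition, no named fact, no `sorry`.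
Registry: pub-hodgecm theta-3 lineage, leaf 2 of the `ĉ`-continuity pair (leaf 1 = `UnitaryGroupAdelicContinuity`).

[GelbartRogawski1991, §3.2 p. 457] restricts a splitting of the big unitary group `G₁ = U(V ⊗ W)` of a dual pair along
`a : U(V) → G₁`, `g ↦ g ⊗ 1`.  When `W` is a LINE (`J_W = (w)`, `w ≠ 0`; the pairs `(U(2,1), U(1))`, `(U(3), U(1))` of the
Hodge/COR-CM transposition lane) `V ⊗ W` is `V` with its form scaled by `w`, so `a` is a bijection — [Liu2021, App. D §D.1]
(«`U(V_e) = U(V)`»); in the tree at the level of points: `dualPairReindex_inl_surjective` (`UnitaryGroupDualPairReindex`).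
This file records the TOPOLOGICAL statement — `a` is a HOMEOMORPHISM — which is what turns a continuity question for a
character of `G₁(𝔸_F)` (e.g. the twisting character `ĉ` of a smooth compatible splitting,
`GelbartRogawski1991/UnitaryDualPairWeilCoinvariantsTwist*`) into one for its `V`-part `ĉ ∘ a` on `U(J_V)(𝔸_F)`:

* §1 generic (`S` a commutative ring with a topology, `m` a singleton, `H_W(⋆,⋆)` a unit):
  `kronecker_submatrix_prodUnique_symm` (`H_V ⊗ₖ H_W` read on `n` is `w • H_V`),
  `mem_iff_reindexEquiv_prodUnique_symm_mem` (membership transport along `n ≃ n × m`, via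
  `unitaryGroupOfForm_smul_of_isUnit` of `UnitaryGroupLevelTransport`),
  **`isHomeomorph_dualPairInl_of_line : IsHomeomorph (dualPairInl σ H_V H_W)`** (`a` is the restriction of the
  reindexing `GL_n ≃ₜ* GL_{n × m}`, `GLn.reindexEquiv`), `dualPairInl_surjective_of_line`,
  `continuous_iff_comp_dualPairInl_of_line`;
* the adelic line (`E/F` number fields, `c`, `J_V ∈ M_N(E)`, `J_W ∈ M_1(E)` with `J_W 0 0 ≠ 0`):
  **`isHomeomorph_adelicInl_of_line : IsHomeomorph (adelicInl F E c N 1 J_V J_W)`**, `adelicInl_surjective_of_line`,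
  **`continuous_iff_comp_adelicInl_of_line`** / `continuous_iff_continuous_comp_adelicInl_of_line`
  (`Continuous χ ↔ Continuous (χ.comp adelicInl)` for `χ : G₁(𝔸_F) →* A`);
* §3 ONE CALL (CM, rank three, `J_V = diagonal d`, sub-namespace `AdelicContinuity`):
  **`continuous_pair_of_level_of_continuous_centre`** — an abstract character `ĉ` of `G₁(𝔸)` whose `V`-part has an open
  level at the finite places and is continuous on the archimedean centre is continuous (`UnitaryGroupAdelicContinuity` §2
  transported along §2).

An algebraic twin (a `MulEquiv` in the opposite direction, no topology) exists on the Summits side as the stage-1 port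
`Summits/HodgeConjecture/HodgeCM/Model/AdelicLinePair.lean` (`HodgeCM.LinePair.linePairEquiv`, `adelicLinePairEquiv`);
Literature cannot import it, and the topological statements are new.

## References
* [GelbartRogawski1991] S. Gelbart, J. Rogawski, *L-functions and Fourier–Jacobi coefficients for the unitary group
  U(3)*, Invent. Math. 105 (1991) 445–472, §3.2 p. 457 (`a : U(V) → G₁`).
* [Liu2021] Y. Liu, *Fourier–Jacobi cycles and arithmetic relative trace formula*, Camb. J. Math. 9 (2021), App. D §D.1.
* [MoeglinVignerasWaldspurger1987] C. Mœglin, M.-F. Vignéras, J.-L. Waldspurger, LNM 1291, Chap. 1 I.17 (dual pairs).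
-/

set_option autoImplicit false

noncomputable section

open scoped Matrix Kronecker
open NumberField

namespace Literature.NumberTheory.Automorphic

namespace UnitaryGroup

/-! ## §1 A hermitian LINE `W`: `a : U(σ, H_V) → U(σ, H_V ⊗ₖ H_W)`, `g ↦ g ⊗ 1`, is a homeomorphism (so an isomorphism of
topological groups; continuity questions on `G₁ = U(V ⊗ W)` are questions on `U(V)`) -/

section Line

variable {S : Type*} [CommRing S] {n m : Type*} [Fintype n] [DecidableEq n] [Fintype m] [DecidableEq m] [Unique m]
variable (σ : S →+* S) (HV : Matrix n n S) (HW : Matrix m m S)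

omit [Fintype n] [DecidableEq n] [Fintype m] [DecidableEq m] in
/-- for `m` a singleton, `H_V ⊗ₖ H_W` read on `n` along `n ≃ n × m` is `w • H_V`, `w = H_W(⋆, ⋆)` (`V ⊗ W` is `V` with its
form scaled by `w`). [cite: Liu2021, App. D §D.1 Steps 1–2 (l. 5214–5219)] -/
theorem kronecker_submatrix_prodUnique_symm :
    (HV ⊗ₖ HW).submatrix (Equiv.prodUnique n m).symm (Equiv.prodUnique n m).symm = HW default default • HV := by
  ext i j
  simp only [Matrix.submatrix_apply, Equiv.prodUnique_symm_apply, Matrix.kroneckerMap_apply, Matrix.smul_apply,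
    smul_eq_mul, mul_comm]

/-- membership transport: `g ∈ U(σ, H_V)` iff `g` reindexed along `n ≃ n × m` lies in `U(σ, H_V ⊗ₖ H_W)` — the reindexed
form is `w • H_V` and `U(σ, w • H_V) = U(σ, H_V)` (`unitaryGroupOfForm_smul_of_isUnit`).
[cite: Liu2021, App. D §D.1 Steps 1–2 (l. 5214–5219)] -/
theorem mem_iff_reindexEquiv_prodUnique_symm_mem [TopologicalSpace S] (hw : IsUnit (HW default default)) (g : GL n S) :
    g ∈ unitaryGroupOfForm σ HV ↔
      GLn.reindexEquiv (R := S) (Equiv.prodUnique n m).symm g ∈ unitaryGroupOfForm σ (HV ⊗ₖ HW) := by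
  have h := reindex_mem_unitaryGroupOfForm_iff σ (Equiv.prodUnique n m).symm (HV ⊗ₖ HW) g
  rw [kronecker_submatrix_prodUnique_symm, unitaryGroupOfForm_smul_of_isUnit σ hw] at h
  exact h

/-- **For a hermitian LINE `W` (`m` a singleton, `H_W = (w)` with `w` a unit) the `V`-member `a : g ↦ g ⊗ 1` of the dual
pair is a HOMEOMORPHISM `U(σ, H_V) → U(σ, H_V ⊗ₖ H_W)`**: it is the restriction of the reindexing `GL_n ≃ₜ* GL_{n × m}` along
`n ≃ n × m`, which carries `U(σ, H_V) = U(σ, w • H_V)` onto `U(σ, H_V ⊗ₖ H_W)` (`U(V ⊗ W) = U(V)` for a line `W`: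
[Liu2021, App. D §D.1]; at the level of points cf. the tree's `dualPairReindex_inl_surjective`).
[cite: Liu2021, App. D §D.1 Steps 1–2 (l. 5214–5219)] -/
theorem isHomeomorph_dualPairInl_of_line [TopologicalSpace S] (hw : IsUnit (HW default default)) :
    IsHomeomorph (dualPairInl σ HV HW) := by
  let e : unitaryGroupOfForm σ HV ≃ₜ* unitaryGroupOfForm σ (HV ⊗ₖ HW) :=
    ContinuousMulEquiv.restrictSubgroup (GLn.reindexEquiv (R := S) (Equiv.prodUnique n m).symm) _ _
      (mem_iff_reindexEquiv_prodUnique_symm_mem σ HV HW hw)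
  have he : (fun g => e g) = dualPairInl σ HV HW := by
    funext g
    refine Subtype.ext (Units.ext (Matrix.ext fun a b => ?_))
    obtain ⟨i, k⟩ := a
    obtain ⟨j, k'⟩ := b
    obtain rfl : k = default := Unique.eq_default k
    obtain rfl : k' = default := Unique.eq_default k'
    simp only [e, ContinuousMulEquiv.coe_restrictSubgroup_apply, GLn.coe_reindexEquiv_apply, Matrix.reindex_apply,
      Matrix.submatrix_apply, Equiv.symm_symm, Equiv.prodUnique_apply, dualPairInl_apply, coe_dualPair,
      Matrix.kroneckerMap_apply, OneMemClass.coe_one, Units.val_one, Matrix.one_apply_eq, mul_one]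
  rw [← he]
  exact e.toHomeomorph.isHomeomorph

/-- hence `a` is onto for a line. [cite: Liu2021, App. D §D.1 Steps 1–2 (l. 5214–5219)] -/
theorem dualPairInl_surjective_of_line [TopologicalSpace S] (hw : IsUnit (HW default default)) :
    Function.Surjective (dualPairInl σ HV HW) :=
  (isHomeomorph_dualPairInl_of_line σ HV HW hw).bijective.2

/-- and a map out of `U(σ, H_V ⊗ₖ H_W)` is continuous iff its composite with `a` is.
[cite: GelbartRogawski1991, §3.2 p. 457] -/
theorem continuous_iff_comp_dualPairInl_of_line [TopologicalSpace S] (hw : IsUnit (HW default default)) {X : Type*}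
    [TopologicalSpace X] (f : unitaryGroupOfForm σ (HV ⊗ₖ HW) → X) :
    Continuous f ↔ Continuous (f ∘ dualPairInl σ HV HW) :=
  (isHomeomorph_dualPairInl_of_line σ HV HW hw).isQuotientMap.continuous_iff

end Line

/-! ### The adelic line: `a : U(J_V)(𝔸_F) → G₁(𝔸_F) = U(J_V ⊗ J_W)(𝔸_F)` for `J_W = (w)`, `w ≠ 0` -/

section AdelicLine

variable (F E : Type) [Field F] [NumberField F] [Field E] [NumberField E] [Algebra F E] (c : E ≃ₐ[F] E) (N : ℕ)
variable (JV : Matrix (Fin N) (Fin N) E) (JW : Matrix (Fin 1) (Fin 1) E)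

omit [NumberField F] in
/-- **`a : U(J_V)(𝔸_F) → G₁(𝔸_F)` is a homeomorphism for a hermitian line `J_W = (w)`, `w ≠ 0`.**
[cite: GelbartRogawski1991, §3.2 p. 457] -/
theorem isHomeomorph_adelicInl_of_line (hJW : JW 0 0 ≠ 0) : IsHomeomorph (adelicInl F E c N 1 JV JW) :=
  isHomeomorph_dualPairInl_of_line (conjAdele F E c) (adelicForm E N JV) (adelicForm E 1 JW)
    ((IsUnit.mk0 _ hJW).map (algebraMap E (AdeleRing (𝓞 E) E)) :)

omit [NumberField F] in
/-- `a` is onto for a line. [cite: GelbartRogawski1991, §3.2 p. 457] -/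
theorem adelicInl_surjective_of_line (hJW : JW 0 0 ≠ 0) : Function.Surjective (adelicInl F E c N 1 JV JW) :=
  (isHomeomorph_adelicInl_of_line F E c N JV JW hJW).bijective.2

omit [NumberField F] in
/-- **a map out of `G₁(𝔸_F)` (`W` a line) is continuous iff its composite with `a : U(J_V)(𝔸_F) → G₁(𝔸_F)` is.**
[cite: GelbartRogawski1991, §3.2 p. 457] -/
theorem continuous_iff_comp_adelicInl_of_line (hJW : JW 0 0 ≠ 0) {X : Type*} [TopologicalSpace X]
    (f : adelicPair F E c N 1 JV JW → X) : Continuous f ↔ Continuous (f ∘ adelicInl F E c N 1 JV JW) :=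
  (isHomeomorph_adelicInl_of_line F E c N JV JW hJW).isQuotientMap.continuous_iff

omit [NumberField F] in
/-- the same for a homomorphism `χ : G₁(𝔸_F) →* A`: `χ` is continuous iff `χ ∘ a` is. [cite: GelbartRogawski1991, §3.2 p. 457] -/
theorem continuous_iff_continuous_comp_adelicInl_of_line (hJW : JW 0 0 ≠ 0) {A : Type*} [Monoid A]
    [TopologicalSpace A] (χ : adelicPair F E c N 1 JV JW →* A) :
    Continuous χ ↔ Continuous (χ.comp (adelicInl F E c N 1 JV JW)) :=
  continuous_iff_comp_adelicInl_of_line F E c N JV JW hJW χ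

end AdelicLine

/-! ## §3 ONE CALL in the pair currency (CM, rank `3`, `J_V = diagonal d`, `W` a line): level of the `V`-part + continuity
on the archimedean centre ⇒ `Continuous ĉ` on `G₁(𝔸)` — `UnitaryGroupAdelicContinuity` §2 transported along §2 above -/

namespace AdelicContinuity

variable (L : Type) [Field L] [NumberField L] [IsCMField L]
variable {A : Type*} [CommGroup A] [TopologicalSpace A]
variable (d : Fin 3 → L) (hd : ∀ i, IsCMField.complexConj L (d i) = d i) (hd0 : ∀ i, d i ≠ 0)

include hd hd0 in
/-- **`W` a line, `V` of rank three: an abstract character `ĉ` of `G₁(𝔸_{L⁺}) = U(J_V ⊗ J_W)(𝔸_{L⁺})` whose `V`-part has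
an open level at the finite places (the `twistCharV` conjunct of the smooth-splitting normal form) and is continuous
on the archimedean centre is continuous.**  [cite: GelbartRogawski1991, §3.1 Remark p. 457 L4–13] -/
theorem continuous_pair_of_level_of_continuous_centre [ContinuousMul A] (JW : Matrix (Fin 1) (Fin 1) L) (hJW : JW 0 0 ≠ 0)
    (ĉ : ↥(UnitaryGroup.adelicPair (↥(maximalRealSubfield L)) L (IsCMField.complexConj L) 3 1 (Matrix.diagonal d) JW) →* A)
    (hlev : ∃ K : Subgroup ↥(UnitaryGroup.finAdelic (↥(maximalRealSubfield L)) L (IsCMField.complexConj L) 3 (Matrix.diagonal d)),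
      IsOpen (K : Set ↥(UnitaryGroup.finAdelic (↥(maximalRealSubfield L)) L (IsCMField.complexConj L) 3 (Matrix.diagonal d))) ∧
      ∀ k ∈ K, ĉ (UnitaryGroup.adelicInl (↥(maximalRealSubfield L)) L (IsCMField.complexConj L) 3 1
        (Matrix.diagonal d) JW (finAdelicToAdelic (↥(maximalRealSubfield L)) L (IsCMField.complexConj L) 3 (Matrix.diagonal d) k)) = 1)
    (hcen : Continuous fun y => ĉ (UnitaryGroup.adelicInl (↥(maximalRealSubfield L)) L (IsCMField.complexConj L) 3 1
        (Matrix.diagonal d) JW (archToAdelic (↥(maximalRealSubfield L)) L (IsCMField.complexConj L) 3 (Matrix.diagonal d)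
          (cmArchCenter L 3 (Matrix.diagonal d) y)))) :
    Continuous ĉ :=
  (UnitaryGroup.continuous_iff_continuous_comp_adelicInl_of_line (↥(maximalRealSubfield L)) L (IsCMField.complexConj L) 3
      (Matrix.diagonal d) JW hJW ĉ).2
    (continuous_of_level_of_continuous_centre L d hd hd0 (ĉ.comp (UnitaryGroup.adelicInl (↥(maximalRealSubfield L)) L
      (IsCMField.complexConj L) 3 1 (Matrix.diagonal d) JW)) hlev hcen)

end AdelicContinuity

end UnitaryGroup

end Literature.NumberTheory.Automorphic

end
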